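import Literature.AnabelianGeometry.AbsoluteAnabelian.MLFGaloisTFGProofs
import Literature.AnabelianGeometry.AbsoluteAnabelian.NFGaloisTFGNormalProofs
import Literature.AnabelianGeometry.AbsoluteAnabelian.AbsTopIThm26iiStarProofs
import Literature.AnabelianGeometry.AbsoluteAnabelian.AbsTopIThm26iiProSigmaProofs
import Literature.AnabelianGeometry.AbsoluteAnabelian.AbsTopIThm26viProofs
import Literature.AnabelianGeometry.AbsoluteAnabelian.AbsTopIThm26ivThm214Proofs
import Literature.AnabelianGeometry.AbsoluteAnabelian.MLFGaloisElasticProofs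
import Literature.AnabelianGeometry.AbsoluteAnabelian.GaloisSubextensionProofs
import HarnessLib

/-!
# [AbsTopI] Thm 2.6 (ii), (vi) and Thm 2.14 (i): the named inputs on `G` re-keyed to landed theorems

S. Mochizuki, *Topics in Absolute Anabelian Geometry I: Generalities* (2012) [AbsTopI], Thm 2.6
(ii) (`k` an MLF) and (vi) (`k` an NF), manuscript pp. 21–22 (lit key `paper:url-11ac98ba15fc`),
proof p. 23:

  "To verify assertion (ii), let us first observe that the topological finite generation of `Π`
   follows from that of `Δ` [cf. Proposition 2.2], together with that of `G` [cf. [NSW], Theorem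
   7.5.10]."  (ll. 11–13)
  "In a similar vein, assertion (vi) follows immediately from the fact that `T_l(A)/G = 0` [...],
   together with the fact that `G` is very elastic [cf. Theorem 1.7, (iii)]."  (ll. 7–10)

The kernel closers of abc-iut-L4-t4's typed predicates `FundamentalExtension.Thm26ii B S`
(`thm26ii_of_starCondition`, case `Σ ⊇ Primes`; `thm26ii_of_starCondition_of_isProSet`, general
`Σ`) and `FundamentalExtension.Thm26vi` (`thm26vi_of_tfgNormalSubgroup_trivial`) carry the two
inputs ON `G` as bare hypotheses: «`G` is topologically finitely generated»
(`hG : IsTopologicallyFinitelyGenerated E.gal`, GAP-LEDGER G-L4t4-2) and [AbsAnab] Thm 1.1.2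
(`h112 : galoisNF_tfgNormalSubgroup_trivial`, FACT-LIST F-0031 — the content of "`G` is very
elastic" that (vi) uses).  Both are now THEOREMS of the tree:

* abc-iut-L4-d1's `isTopologicallyFinitelyGenerated_absoluteGaloisGroup_padic_of_localEPC`
  (`MLFGaloisTFGProofs.lean`, Gaschütz route): `Gal(K̄/K)` is topologically finitely generated for
  every finite `K/ℚ_p`, GIVEN Tate's local Euler–Poincaré characteristic
  `localEulerPoincareCharacteristic F` for all non-archimedean local fields `F` of characteristic `0`
  (the tree's named fact; it HAS a kernel proof, `localEulerPoincareCharacteristic_holds`, filed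
  Summits-side and therefore not importable under `Literature/`);
* abc-iut-L4-d2's `galoisNF_tfgNormalSubgroup_trivial_holds` (`NFGaloisTFGNormalProofs.lean`):
  [AbsAnab] Thm 1.1.2, unconditionally;
* and, for the group part of Thm 2.14 (i) (`Thm214GroupPart`, whose closer
  `MLFBase.thm214GroupPart_of_isElastic_gal` of abc-iut-w5-d206 carries «`Gᵢ` elastic», [AbsTopI]
  Thm 1.7 (ii), as `hG₁ hG₂ : IsElastic _`): abc-iut-w5-d206/L4-t15's `MLFBase.isElastic_gal`
  (`MLFGaloisElasticProofs.lean`): `G_k` is elastic for every finite `k/ℚ_p`, unconditionally.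

This proof-only file (no definitions, no new named facts) performs the consumer-side re-keying
(abc-iut-L4-lead RULING #3x (c)):

* `MLFBase.isTopologicallyFinitelyGenerated_gal_of_localEPC` — along the base datum
  `B.galIso : G ≃ₜ* G_K` of an MLF base, `G` is topologically finitely generated GIVEN `hEP`;
* `MLFBase.isTopologicallyFinitelyGenerated_arith_of_localEPC` — the FIRST CLAUSE of Thm 2.6 (ii),
  «`Π` is topologically finitely generated», GIVEN Prop 2.2 (`E.GeomTFG`) and `hEP`: exactly the
  printed deduction quoted above;
* `thm26ii_of_starCondition_of_localEPC`, `thm26ii_of_starCondition_of_isProSet_of_localEPC` — the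
  two (ii)-closers with `hG` replaced by `hEP`;
* `NFBase.thm26vi_of_invariantCharacters_trivial` — the (vi)-closer with `h112` DISCHARGED;
* `MLFBase.thm214GroupPart`, `MLFBase.exists_continuousMulEquiv_gal` — Thm 2.14 (i), group part,
  in the `Σᵢ ≠ Primes` regime, with the elasticity inputs DISCHARGED (via `MLFBase.preservesGeom`).

After this file, for every abstract extension `1 → Δ → Π → G → 1` with the stated base data, the
typed Thm 2.6 (ii) rests on: Prop 2.2 (`GeomTFG`), `Δ` pro-`Σ` (general-`Σ` form), the splitting
over an open subgroup of `G` and condition (∗) of [AbsAnab] Lemma 1.1.4 (ii) (F-0011, F-0012), and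
Tate's local Euler–Poincaré characteristic — all NAMED; the typed Thm 2.6 (vi) rests on Prop 2.2 and
the group-theoretic content of «`T_l(A)/G = 0`» (GAP-LEDGER G-L4t4-1) only; the typed Thm 2.14 (i)
group part (regime `Σᵢ ≠ Primes`) rests on Prop 2.2 and «`Δᵢ` pro-`Σᵢ`» only.  HONEST FRAMING:
[AbsTopI] and [AbsAnab] are refereed, undisputed papers; the geometric inputs remain hypotheses
(they are what the campaign's `π₁` construction must supply); nothing here bears on [IUTchIII]
Cor. 3.12 or asserts anything about abc.
-/

noncomputable section

open Field Topology

namespace Literature.AnabelianGeometry.AbsoluteAnabelian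

open Literature.NumberTheory.GaloisRepresentations

namespace FundamentalExtension

variable {E : FundamentalExtension.{0}}

/-! ### Thm 2.6 (ii): «`G` topologically finitely generated» from Tate's Euler–Poincaré characteristic -/

/-- **[AbsTopI] Thm 2.6 (ii) input «[NSW], Theorem 7.5.10» at an MLF base**, GIVEN Tate's local
Euler–Poincaré characteristic: for every extension `1 → Δ → Π → G → 1` with MLF base data `B`
(`G ≅ G_K`, `K/ℚ_p` finite), `G` is topologically finitely generated — abc-iut-L4-d1's
`ℚ_p`-binder theorem transported along `B.galIso`.
[cite: MochizukiAbsTopI2012, Thm 2.6 (ii) proof p.23] [cite: NeukirchSchmidtWingberg2008, Thm. 7.5.10] -/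
theorem MLFBase.isTopologicallyFinitelyGenerated_gal_of_localEPC (B : E.MLFBase)
    (hEP : ∀ (F : Type) [Field F] [ValuativeRel F] [TopologicalSpace F]
      [IsNonarchimedeanLocalField F] [CharZero F], localEulerPoincareCharacteristic F) :
    IsTopologicallyFinitelyGenerated E.gal :=
  letI := B.instPrime; letI := B.instField; letI := B.instAlgebra; letI := B.instFinite
  (isTopologicallyFinitelyGenerated_absoluteGaloisGroup_padic_of_localEPC hEP B.p B.K)
    |>.of_continuousMulEquiv B.galIso.symm

/-- **[AbsTopI] Thm 2.6 (ii), first clause «`Π` is topologically finitely generated»**, the printed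
deduction (proof p. 23: "the topological finite generation of `Π` follows from that of `Δ`
[cf. Proposition 2.2], together with that of `G` [cf. [NSW], Theorem 7.5.10]") kernel-checked for
every extension with MLF base data, GIVEN Prop 2.2 (`E.GeomTFG`) and Tate's local Euler–Poincaré
characteristic. [cite: MochizukiAbsTopI2012, Thm 2.6 (ii) p.21] -/
theorem MLFBase.isTopologicallyFinitelyGenerated_arith_of_localEPC (B : E.MLFBase)
    (hΔ : E.GeomTFG)
    (hEP : ∀ (F : Type) [Field F] [ValuativeRel F] [TopologicalSpace F]
      [IsNonarchimedeanLocalField F] [CharZero F], localEulerPoincareCharacteristic F) :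
    IsTopologicallyFinitelyGenerated E.arith :=
  IsTopologicallyFinitelyGenerated.of_extension E.aug E.aug_surjective hΔ
    (B.isTopologicallyFinitelyGenerated_gal_of_localEPC hEP)

/-- **[AbsTopI] Thm 2.6 (ii) AS TYPED, case `Σ ⊇ Primes`**, for every extension with MLF base data,
GIVEN (a) Prop 2.2 `E.GeomTFG`, (b) Tate's local Euler–Poincaré characteristic (replacing the bare
hypothesis «`G` topologically finitely generated» of `thm26ii_of_starCondition`), (c) a splitting
over an open subgroup of `G`, (d) condition (∗) of [AbsAnab] Lemma 1.1.4 (ii).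
[cite: MochizukiAbsTopI2012, Thm 2.6 (ii) p.21] -/
theorem thm26ii_of_starCondition_of_localEPC (B : E.MLFBase) (S : Set ℕ)
    (hS : ∀ l : ℕ, l.Prime → l ∈ S) (hΔ : E.GeomTFG)
    (hEP : ∀ (F : Type) [Field F] [ValuativeRel F] [TopologicalSpace F]
      [IsNonarchimedeanLocalField F] [CharZero F], localEulerPoincareCharacteristic F)
    (hs : E.SplitsOverOpenSubgroup) (hstar : E.StarCondition) : E.Thm26ii B S :=
  thm26ii_of_starCondition B S hS hΔ (B.isTopologicallyFinitelyGenerated_gal_of_localEPC hEP)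
    hs hstar

/-- **[AbsTopI] Thm 2.6 (ii) AS TYPED, general `Σ`**, for every extension with MLF base data, GIVEN
(a) Prop 2.2 `E.GeomTFG`, (b) Tate's local Euler–Poincaré characteristic (replacing the bare
hypothesis «`G` topologically finitely generated» of `thm26ii_of_starCondition_of_isProSet`),
(c) `Δ` pro-`Σ`, (d) a splitting over an open subgroup of `G`, (e) condition (∗) of [AbsAnab] Lemma
1.1.4 (ii).  HONEST SCOPE as in the sibling: for `Σ ≠ Primes`, (c) + (e) force the `Ẑ`-rank of (∗)
to vanish. [cite: MochizukiAbsTopI2012, Thm 2.6 (ii) p.21] -/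
theorem thm26ii_of_starCondition_of_isProSet_of_localEPC (B : E.MLFBase) (S : Set ℕ)
    (hΔ : E.GeomTFG)
    (hEP : ∀ (F : Type) [Field F] [ValuativeRel F] [TopologicalSpace F]
      [IsNonarchimedeanLocalField F] [CharZero F], localEulerPoincareCharacteristic F)
    (hpro : IsProSet E.geom S) (hs : E.SplitsOverOpenSubgroup) (hstar : E.StarCondition) :
    E.Thm26ii B S :=
  thm26ii_of_starCondition_of_isProSet B S hΔ (B.isTopologicallyFinitelyGenerated_gal_of_localEPC hEP)
    hpro hs hstar

/-! ### Thm 2.6 (vi): [AbsAnab] Thm 1.1.2 discharged -/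

/-- **[AbsTopI] Thm 2.6 (vi) AS TYPED**, for EVERY extension `1 → Δ → Π → G → 1` of profinite groups
with `G ≅ G_F`, `F` a number field, GIVEN only (a) Prop 2.2 (`E.GeomTFG`) and (b) the group-theoretic
content of «`T_l(A)/G = 0`» (every `Π`-invariant continuous character `Δ → ℤ_l` is trivial,
GAP-LEDGER G-L4t4-1); the third printed input, [AbsAnab] Thm 1.1.2 («`G` is very elastic»), is
supplied by the landed theorem `galoisNF_tfgNormalSubgroup_trivial_holds`.
[cite: MochizukiAbsTopI2012, Thm 2.6 (vi) p.22] [cite: MochizukiAbsAnab2004, Thm 1.1.2 p.6] -/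
theorem NFBase.thm26vi_of_invariantCharacters_trivial (B : E.NFBase) (hΔ : E.GeomTFG)
    (hT : ∀ (l : ℕ) [Fact l.Prime] (ψ : E.geom →ₜ* Multiplicative ℤ_[l]),
      (∀ (g : E.arith) (d d' : E.geom), (d' : E.arith) = g * d * g⁻¹ → ψ d' = ψ d) →
        ∀ d, ψ d = 1) :
    E.Thm26vi :=
  E.thm26vi_of_tfgNormalSubgroup_trivial B hΔ galoisNF_tfgNormalSubgroup_trivial_holds hT

/-! ### Thm 2.14 (i), group part: [AbsTopI] Thm 1.7 (ii) («`G_k` elastic») discharged -/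

variable {F : FundamentalExtension.{0}}

/-- **[AbsTopI] Thm 2.14 (i), group-theoretic part, regime `Σᵢ ≠ Primes`** (typed predicate
`Thm214GroupPart B₁ B₂ φ`: "`p₁ = p₂`", `φ(Δ₁) = Δ₂`, equal minimal almost-pro sets), for two
extensions with MLF base data, GIVEN only Prop 2.2 on both sides (`GeomTFG`) and the construction
data «`Δᵢ` pro-`Σᵢ`» with `Σᵢ ⊊ Primes`: EVERY isomorphism of profinite groups `φ : Π₁ ⥲ Π₂`
satisfies it.  abc-iut-w5-d206's `MLFBase.thm214GroupPart_of_isElastic_gal` with its two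
elasticity inputs ([AbsTopI] Thm 1.7 (ii)) supplied by the landed `MLFBase.isElastic_gal`.
[cite: MochizukiAbsTopI2012, Thm 2.14 (i) p.33] -/
theorem MLFBase.thm214GroupPart (B₁ : E.MLFBase) (B₂ : F.MLFBase) (hΔ₁ : E.GeomTFG)
    (hΔ₂ : F.GeomTFG) {S T : Set ℕ} (hS : S ⊆ {q | q.Prime}) (hS' : S ≠ {q | q.Prime})
    (hES : IsProSet E.geom S) (hT : T ⊆ {q | q.Prime}) (hT' : T ≠ {q | q.Prime})
    (hFT : IsProSet F.geom T) (φ : E.arith ≃ₜ* F.arith) : Thm214GroupPart B₁ B₂ φ :=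
  (MLFBase.preservesGeom B₁ B₂ hΔ₁ hΔ₂ hS hS' hES hT hT' hFT φ).thm214GroupPart B₁ B₂

/-- Under the same inputs (Prop 2.2 and «`Δᵢ` pro-`Σᵢ`», `Σᵢ ⊊ Primes`; elasticity discharged): the
bicontinuous isomorphism `G₁ ⥲ G₂` induced by `φ`, compatible with the augmentations ("`φ` induces
isomorphisms `Δ₁ ⥲ Δ₂`, `G₁ ⥲ G₂`"). [cite: MochizukiAbsTopI2012, Thm 2.14 (i) p.33] -/
theorem MLFBase.exists_continuousMulEquiv_gal (B₁ : E.MLFBase) (B₂ : F.MLFBase)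
    (hΔ₁ : E.GeomTFG) (hΔ₂ : F.GeomTFG) {S T : Set ℕ} (hS : S ⊆ {q | q.Prime})
    (hS' : S ≠ {q | q.Prime}) (hES : IsProSet E.geom S) (hT : T ⊆ {q | q.Prime})
    (hT' : T ≠ {q | q.Prime}) (hFT : IsProSet F.geom T) (φ : E.arith ≃ₜ* F.arith) :
    ∃ β : E.gal ≃ₜ* F.gal, ∀ x : E.arith, β (E.aug x) = F.aug (φ x) :=
  (MLFBase.preservesGeom B₁ B₂ hΔ₁ hΔ₂ hS hS' hES hT hT' hFT φ).exists_continuousMulEquiv_gal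

end FundamentalExtension

end Literature.AnabelianGeometry.AbsoluteAnabelian

end
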